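import Mathlib
import HarnessLib
import Summits.ValiantsHypothesis.ValiantsHypothesis.Theorems.LacunarySymmetroidMatrixDescartesProductPlusOneTameReverse
import Summits.ValiantsHypothesis.ValiantsHypothesis.Theorems.LacunarySymmetroidMatrixDescartesProductPlusOneLowerSignedMembers

/-!
# ValiantsHypothesis / LacunarySymmetroid — crux `MatrixDescartes` (stmt-ValiantsHypothesis-18050, V1),
# LINE (A) «product_plus_one», `stub_classRowK3` / S5 member currency: SIGN-AWARE member counts at the TOP coupling (mirrors)

`x ↦ 1/x` companions, in MEMBER currency, of ✓ `lowerSigned_sector_classK_signed` (val-lit-p7 g15, p671486) and of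
✓ `coherent_sector_classK_signed` (val-lit-p7 g14, p667707):

* ★ `upperSigned_sector_classK_signed` — every format `K ≥ 2`, every strictly increasing support, TOP coupling `l₀ = K−1`, every factor
  with its coefficients ABOVE THE BOTTOM LETTER weakly one-signed (bottom coefficient free, zeros allowed):
  `Z₊(C c·X^{m d_{K−1}} + ∏ f_j) ≤ #{j : some a_{jl} (l ≥ 1) has a_{jl}·a_{j0} < 0} + 2`
  (reversal `card_pos_roots_class_reverse` of ✓ `…TameReverse` on the member, letter re-indexing `l ↦ K−1−l`, then the bottom theorem);
* ★ `coherent_sector_classK_top_signed` — `K ≥ 3`, `a_{j,K−1}·a_{jl} > 0` for `l ≥ 1` (bottom coefficient free; in particular the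
  coherent factors with their single sign change at the BOTTOM letter), top coupling: `Z₊ ≤ m + 2` (the sign-aware form of
  ✓ `coherentK_sector_class_top`'s `2m + 2`);
* the `K = 3` rows in line shape (`d 0 < d 1 < d 2`): `classRowK3_upperSigned_signed`, `classRowK3_coherentTop_signed` (≤ `m + 2`) and, at the
  bottom coupling, `classRowK3_coherentBottom_signed` (≤ `m + 2`, from ✓ `classRowK3_lowerSigned_signed`) — the line's rev-14 rows
  `classRowK3_coherentBottom/Top` carry `2m + 3`.

HONEST FRAMING: bookkeeping corollaries (reversal + re-indexing); NOT `stub_classRowK3`, not `stub_polyLaw`, not `ProductPlusOneMDR`, not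
`MatrixDescartes`, not Conjecture B; `VP ≠ VNP` is NOT proved.  No definitions, no named facts.
-/

set_option linter.dupNamespace false

namespace Summit.ValiantsHypothesis.ValiantsHypothesis.Theorems.LacunarySymmetroidMatrixDescartes

namespace ProductPlusOne

open Polynomial Finset
open scoped BigOperators

/-- Re-indexing the letters of a member by a permutation `σ` of `Fin K` changes nothing. [folklore] -/
theorem member_reindex {m K : ℕ} (σ : Equiv.Perm (Fin K)) (d : Fin K → ℕ) (a : Fin m → Fin K → ℝ) (N : ℕ) (c : ℝ) :
    (C c * X ^ N + ∏ j, ∑ l, C (a j (σ l)) * X ^ (d (σ l)) : ℝ[X]) = C c * X ^ N + ∏ j, ∑ l, C (a j l) * X ^ (d l) := by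
  congr 1
  exact Finset.prod_congr rfl fun j _ => Equiv.sum_comp σ (fun l => C (a j l) * X ^ (d l))

/-- ★ **THE UPPER-SIGNED SECTOR AT THE TOP COUPLING, SIGN-AWARE member count, EVERY FORMAT** (`2 ≤ K`, `d` strictly increasing, top
coupling `l₀ = K−1`, every factor with its coefficients above the bottom letter weakly one-signed — bottom coefficient free):
`Z₊(C c·X^{m d_{K−1}} + ∏ f_j) ≤ #{j : ∃ l ≥ 1, a_{jl}·a_{j0} < 0} + 2`.  Mirror of ✓ `lowerSigned_sector_classK_signed`. [this file's theorem] -/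
theorem upperSigned_sector_classK_signed {m K : ℕ} (hK : 2 ≤ K) (d : Fin K → ℕ) (hd : StrictMono d) (a : Fin m → Fin K → ℝ)
    (hus : ∀ j, (∀ l : Fin K, 0 < (l : ℕ) → 0 ≤ a j l) ∨ (∀ l : Fin K, 0 < (l : ℕ) → a j l ≤ 0)) (c : ℝ) :
    ((C c * X ^ (m * d ⟨K - 1, by omega⟩) + ∏ j, ∑ l, C (a j l) * X ^ (d l) : ℝ[X]).roots.toFinset.filter
      (fun t => 0 < t)).card
      ≤ (Finset.univ.filter (fun j => ∃ l : Fin K, 0 < (l : ℕ) ∧ a j l * a j ⟨0, by omega⟩ < 0)).card + 2 := by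
  classical
  set top : Fin K := ⟨K - 1, by omega⟩ with htop
  set D : ℕ := d top with hDdef
  have hD : ∀ l, d l ≤ D := fun l => hd.monotone (Fin.mk_le_mk.mpr (by have := l.isLt; omega) : l ≤ top)
  rw [← card_pos_roots_class_reverse d D hD a top c]
  -- re-index the letters by `Fin.rev`
  set σ : Equiv.Perm (Fin K) := Fin.revPerm with hσ
  set d' : Fin K → ℕ := fun l => D - d (σ l) with hd'
  set a' : Fin m → Fin K → ℝ := fun j l => a j (σ l) with ha'
  have hσ0 : σ ⟨0, by omega⟩ = top := by
    rw [hσ, htop]; ext; simp [Fin.revPerm_apply, Fin.rev]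
  have hσtop : σ top = ⟨0, by omega⟩ := by
    rw [hσ, htop]; ext; simp [Fin.revPerm_apply, Fin.rev]; omega
  have hd'mono : StrictMono d' := by
    intro i j hij
    simp only [hd']
    have h1 : σ j < σ i := by
      rw [hσ]; simp only [Fin.revPerm_apply]; exact Fin.rev_lt_rev.mpr hij
    have h2 : d (σ j) < d (σ i) := hd h1
    have h3 : d (σ i) ≤ D := hD _
    omega
  have hd'0 : d' ⟨0, by omega⟩ = D - d top := by simp only [hd', hσ0]
  have hshape : (C c * X ^ (m * (D - d top)) + ∏ j, ∑ l, C (a j l) * X ^ (D - d l) : ℝ[X])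
      = C c * X ^ (m * d' ⟨0, by omega⟩) + ∏ j, ∑ l, C (a' j l) * X ^ (d' l) := by
    rw [hd'0]
    exact (member_reindex σ (fun l => D - d l) a (m * (D - d top)) c).symm
  rw [hshape]
  have hls' : ∀ j, (∀ l : Fin K, (l : ℕ) < K - 1 → 0 ≤ a' j l) ∨ (∀ l : Fin K, (l : ℕ) < K - 1 → a' j l ≤ 0) := by
    intro j
    rcases hus j with h | h
    · refine Or.inl fun l hl => ?_
      simp only [ha']
      refine h (σ l) ?_
      rw [hσ]; simp only [Fin.revPerm_apply, Fin.val_rev]; omega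
    · refine Or.inr fun l hl => ?_
      simp only [ha']
      refine h (σ l) ?_
      rw [hσ]; simp only [Fin.revPerm_apply, Fin.val_rev]; omega
  refine (lowerSigned_sector_classK_signed hK d' hd'mono a' hls' c).trans ?_
  -- the two sign-change counts agree (letter `l` of `a'` is letter `K−1−l` of `a`)
  have hfilter : (Finset.univ.filter (fun j => ∃ l : Fin K, (l : ℕ) < K - 1 ∧ a' j l * a' j ⟨K - 1, by omega⟩ < 0))
      = Finset.univ.filter (fun j => ∃ l : Fin K, 0 < (l : ℕ) ∧ a j l * a j ⟨0, by omega⟩ < 0) := by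
    refine Finset.filter_congr fun j _ => ?_
    simp only [ha']
    rw [← htop, hσtop]
    constructor
    · rintro ⟨l, hl, h⟩
      refine ⟨σ l, ?_, h⟩
      rw [hσ]; simp only [Fin.revPerm_apply, Fin.val_rev]; omega
    · rintro ⟨l, hl, h⟩
      refine ⟨σ l, ?_, ?_⟩
      · rw [hσ]; simp only [Fin.revPerm_apply, Fin.val_rev]; omega
      · have : σ (σ l) = l := by rw [hσ]; simp [Fin.revPerm_apply]
        rw [this]; exact h
  rw [hfilter]

/-- ★ **THE COHERENT ONE-ZERO SECTOR AT THE TOP COUPLING, SIGN-AWARE, EVERY FORMAT** (`3 ≤ K`; hypothesis `hcoh` of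
✓ `eulerBound_coherentK_top`: every coefficient above the bottom letter has the strict sign of the top one — the bottom coefficient is
FREE here, so the sign change at the bottom letter (`hbot` there) need not even be assumed): `Z₊(C c·X^{m d_{K−1}} + ∏ f_j) ≤ m + 2`.
Mirror of ✓ `coherent_sector_classK_signed`. [this file's theorem] -/
theorem coherent_sector_classK_top_signed {m K : ℕ} (hK : 3 ≤ K) (d : Fin K → ℕ) (hd : StrictMono d) (a : Fin m → Fin K → ℝ)
    (hcoh : ∀ j (l : Fin K), 0 < (l : ℕ) → 0 < a j ⟨K - 1, by omega⟩ * a j l) (c : ℝ) :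
    ((C c * X ^ (m * d ⟨K - 1, by omega⟩) + ∏ j, ∑ l, C (a j l) * X ^ (d l) : ℝ[X]).roots.toFinset.filter
      (fun t => 0 < t)).card ≤ m + 2 := by
  classical
  have hus : ∀ j, (∀ l : Fin K, 0 < (l : ℕ) → 0 ≤ a j l) ∨ (∀ l : Fin K, 0 < (l : ℕ) → a j l ≤ 0) := by
    intro j
    have htt : 0 < a j ⟨K - 1, by omega⟩ * a j ⟨K - 1, by omega⟩ := hcoh j ⟨K - 1, by omega⟩ (by simp; omega)
    rcases lt_or_gt_of_ne (show a j ⟨K - 1, by omega⟩ ≠ 0 from fun h => by rw [h, mul_zero] at htt; exact lt_irrefl _ htt)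
      with hneg | hpos
    · refine Or.inr fun l hl => ?_
      have := hcoh j l hl
      nlinarith
    · refine Or.inl fun l hl => ?_
      have := hcoh j l hl
      nlinarith
  refine (upperSigned_sector_classK_signed (by omega) d hd a hus c).trans ?_
  have : (Finset.univ.filter (fun j => ∃ l : Fin K, 0 < (l : ℕ) ∧ a j l * a j ⟨0, by omega⟩ < 0)).card ≤ m :=
    (Finset.card_filter_le _ _).trans (by simp)
  omega

/-! ### The `K = 3` rows in line shape -/

/-- `d 0 < d 1 < d 2` on `Fin 3` is `StrictMono d`. [folklore] -/
private theorem strictMono_fin3 (d : Fin 3 → ℕ) (h01 : d 0 < d 1) (h12 : d 1 < d 2) : StrictMono d := by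
  refine Fin.strictMono_iff_lt_succ.2 fun i => ?_
  fin_cases i
  · exact h01
  · exact h12

/-- **The `K = 3` row at the TOP coupling, sign-aware** (`d 0 < d 1 < d 2`, `a_{j1}` and `a_{j2}` weakly one-signed per factor, `a_{j0}` free):
`Z₊(C c·X^{m d 2} + ∏ f_j) ≤ #{j : a_{j1} a_{j0} < 0 ∨ a_{j2} a_{j0} < 0} + 2`. [this file's theorem] -/
theorem classRowK3_upperSigned_signed {m : ℕ} (d : Fin 3 → ℕ) (h01 : d 0 < d 1) (h12 : d 1 < d 2)
    (a : Fin m → Fin 3 → ℝ) (hus : ∀ j, (0 ≤ a j 1 ∧ 0 ≤ a j 2) ∨ (a j 1 ≤ 0 ∧ a j 2 ≤ 0)) (c : ℝ) :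
    ((C c * X ^ (m * d 2) + ∏ j, ∑ l, C (a j l) * X ^ (d l) : ℝ[X]).roots.toFinset.filter (fun t => 0 < t)).card
      ≤ (Finset.univ.filter (fun j => a j 1 * a j 0 < 0 ∨ a j 2 * a j 0 < 0)).card + 2 := by
  classical
  have hus' : ∀ j, (∀ l : Fin 3, 0 < (l : ℕ) → 0 ≤ a j l) ∨ (∀ l : Fin 3, 0 < (l : ℕ) → a j l ≤ 0) := by
    intro j
    rcases hus j with ⟨h1, h2⟩ | ⟨h1, h2⟩
    · refine Or.inl fun l hl => ?_
      fin_cases l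
      · simp at hl
      · exact h1
      · exact h2
    · refine Or.inr fun l hl => ?_
      fin_cases l
      · simp at hl
      · exact h1
      · exact h2
  refine (upperSigned_sector_classK_signed (by norm_num) d (strictMono_fin3 d h01 h12) a hus' c).trans (le_of_eq ?_)
  congr 2
  refine Finset.filter_congr fun j _ => ?_
  constructor
  · rintro ⟨l, hl, h⟩
    fin_cases l
    · simp at hl
    · exact Or.inl h
    · exact Or.inr h
  · rintro (h | h)
    · exact ⟨1, by simp, h⟩
    · exact ⟨2, by simp, h⟩

/-- **The `K = 3` COHERENT row at the TOP coupling, sign-aware** (`a_{j0} a_{j2} < 0`, `a_{j2} a_{j1} ≥ 0`): `Z₊ ≤ m + 2`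
(the line's `classRowK3_coherentTop` says `2m + 3`). [this file's theorem] -/
theorem classRowK3_coherentTop_signed {m : ℕ} (d : Fin 3 → ℕ) (h01 : d 0 < d 1) (h12 : d 1 < d 2)
    (a : Fin m → Fin 3 → ℝ) (hac : ∀ j, a j 0 * a j 2 < 0) (hcb : ∀ j, 0 ≤ a j 2 * a j 1) (c : ℝ) :
    ((C c * X ^ (m * d 2) + ∏ j, ∑ l, C (a j l) * X ^ (d l) : ℝ[X]).roots.toFinset.filter (fun t => 0 < t)).card
      ≤ m + 2 := by
  classical
  have hus : ∀ j, (0 ≤ a j 1 ∧ 0 ≤ a j 2) ∨ (a j 1 ≤ 0 ∧ a j 2 ≤ 0) := by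
    intro j
    have h02 := hac j
    have h21 := hcb j
    rcases lt_or_gt_of_ne (show a j 2 ≠ 0 from fun h => by rw [h, mul_zero] at h02; exact lt_irrefl _ h02) with hneg | hpos
    · exact Or.inr ⟨by nlinarith, hneg.le⟩
    · exact Or.inl ⟨by nlinarith, hpos.le⟩
  refine (classRowK3_upperSigned_signed d h01 h12 a hus c).trans ?_
  have : (Finset.univ.filter (fun j => a j 1 * a j 0 < 0 ∨ a j 2 * a j 0 < 0)).card ≤ m :=
    (Finset.card_filter_le _ _).trans (by simp)
  omega

/-- **The `K = 3` COHERENT row at the BOTTOM coupling, sign-aware** (`a_{j0} a_{j2} < 0`, `a_{j0} a_{j1} ≥ 0`): `Z₊ ≤ m + 2`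
(from ✓ `classRowK3_lowerSigned_signed`; the line's `classRowK3_coherentBottom` says `2m + 3`). [this file's theorem] -/
theorem classRowK3_coherentBottom_signed {m : ℕ} (d : Fin 3 → ℕ) (h01 : d 0 < d 1) (h12 : d 1 < d 2)
    (a : Fin m → Fin 3 → ℝ) (hac : ∀ j, a j 0 * a j 2 < 0) (hab : ∀ j, 0 ≤ a j 0 * a j 1) (c : ℝ) :
    ((C c * X ^ (m * d 0) + ∏ j, ∑ l, C (a j l) * X ^ (d l) : ℝ[X]).roots.toFinset.filter (fun t => 0 < t)).card
      ≤ m + 2 := by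
  classical
  have hls : ∀ j, (0 ≤ a j 0 ∧ 0 ≤ a j 1) ∨ (a j 0 ≤ 0 ∧ a j 1 ≤ 0) := by
    intro j
    have h02 := hac j
    have h01' := hab j
    rcases lt_or_gt_of_ne (show a j 0 ≠ 0 from fun h => by rw [h, zero_mul] at h02; exact lt_irrefl _ h02) with hneg | hpos
    · exact Or.inr ⟨hneg.le, by nlinarith⟩
    · exact Or.inl ⟨hpos.le, by nlinarith⟩
  refine (classRowK3_lowerSigned_signed d h01 h12 a hls c).trans ?_
  have : (Finset.univ.filter (fun j => a j 0 * a j 2 < 0 ∨ a j 1 * a j 2 < 0)).card ≤ m :=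
    (Finset.card_filter_le _ _).trans (by simp)
  omega

end ProductPlusOne

end Summit.ValiantsHypothesis.ValiantsHypothesis.Theorems.LacunarySymmetroidMatrixDescartes
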